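import Summits.HodgeConjecture.HodgeConjecture.Theorems.F0P2dStubSOrbitMap
import Summits.HodgeConjecture.HodgeConjecture.Theorems.F0P2aArchOrthPrelim
import Literature.NumberTheory.Automorphic.AdelicUnitaryGroupDatum
import HarnessLib

/-!
# Crux `H413`, (D) desk sub-line `F0_P2SpectralProjectionD` — STUB (S) `stub_S_cotFormL2Data`:
# the `L²` classes of a holomorphic cotangent form carry the `L²`-level cotangent data

HC_CM is proved only modulo the printed citations until rung 0 closes.  Cell `hodgecm-mathlib`, floor 0, programme P2,
socket (D) `CotangentForms.holCotFormSpectralProjection`, desk sub-line `Cruxes/H413/Lines/F0_P2SpectralProjectionD.lean`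
(F0P2-plan (g2), v1.1, tree sha16 `e1fa5bd1360092b6`), registered stub

  `theorem stub_S_cotFormL2Data : StubSCotFormL2Data`.

This file proves `stubSCotFormL2Data_holds`, whose statement is the body of `StubSCotFormL2Data` BINDER FOR BINDER with
the Lines-local bundles unfolded (s347; nothing imports the Lines module, s380b): `G3 L H` ↦ `adelicGroupData L⁺ L c̄ 3 H`,
the hypothesis structure `IsRegularKernel A` ↦ its four fields as four hypotheses, `IsReproducedAlong` ↦ its body, and the
conclusion structure `IsL2CotPair … ν A u` ↦ the nested conjunction of its six fields `repro ∧ kc ∧ kf ∧ ktype ∧ diffOrbit ∧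
weakHol` in declaration order with `kernelOp`, `orbitP`, `IsWeaklyHol` unfolded.  The registrar's fold is the one-liner
`fun L _ _ _ ι H T hT hdef hrk μ _ ν _ A hA hrep Φ hΦ h2 => let h := stubSCotFormL2Data_holds L ι H T hT hdef hrk μ ν A hA.cont
hA.supp hA.diff hA.contDeriv hrep Φ hΦ h2; ⟨h.1, h.2.1, h.2.2.1, h.2.2.2.1, h.2.2.2.2.1, h.2.2.2.2.2⟩`.

## The mathematics (u = ([Φ·0], [Φ·1]), `Φ ∈ holCotForms` of the CM frame, `[L⁺:ℚ] ≥ 2`, `H` definite off `ι`)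

* `kc`, `kf`, `ktype` (§1 + §2) — the `L²` images of the pointwise right `K_c`-invariance, of the invariance under ONE open
  `K_f ≤ U(H)(𝔸_{L⁺,f})` (★ `F0P2aL2bHolLieSpanPackage.span_iterLieDeriv_hol_regular`: `smoothFun` is generated by vectors fixed
  by open subgroups, a finite sum is fixed by their open intersection) and of the cotangent `K_∞`-type identity
  `Φ(x · ιinf k) = τ(k⁻¹) Φ(x)` (★ `WeightForms.right_equiv`), transported by the dictionary `R(a)[Ψ] = [Ψ(· a)]`
  (★ `SpectrumJunction.toLp_toQuotFun_mul_right`) and ★ `F0P2dStubT.toQuotFun_sum_two_ae_eq`.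
* `repro` — the reproduction `∫ A(u) Φ(y ιinf u) dν(u) = Φ(y)` holds pointwise (hypothesis `IsReproducedAlong`, fed with the weight
  clause and `IsHolGerm` of ★ `mem_holCotForms_iff`), and ★ `F0P2dStubSOrbitMap.sum_integral_smul_rightRegular_toLp_eq_self` lifts it
  to `L²(μ)` (Fubini representative ★ p796993; integrability: `Φ` is continuous, ★ `F0P2aL2bHolLieSpanPackage`, and
  `cmArchSection` is continuous, ★ `continuous_archSectionU21CM`; `A` has compact support).
* `diffOrbit`, `weakHol` — NO kernel is needed: each coordinate `φ = Φ·j` is smooth in the archimedean variable with continuous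
  left-invariant Lie derivatives BOUNDED on the COMPACT quotient (★ `F0P2aL2bHolArchSmooth`, ★ `span_iterLieDeriv_hol_regular` ∕
  `_bounded`, ★ `compactSpace_cmDatum_automorphicQuotient_of_posDef` — this is where `hdef` and `[L⁺:ℚ] ≥ 2` enter) and satisfies
  Cauchy–Riemann `X_{ib} φ = i X_b φ` (★ `F0P2aArchOrthPrelim.lieDeriv_liePMat_I_smul_of_isHolGerm`), so ★
  `F0P2dStubSOrbitMap.differentiableAt_rightRegular_expP_toLp` applies: the `𝔭`-orbit map `b ↦ R(ιinf expP b)[φ]` is Fréchet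
  differentiable at `0` with `ℂ`-linear differential.

## References

* [Borel1997] A. Borel, *Automorphic forms on SL₂(ℝ)*, Cambridge Tracts in Math. 130 (1997), §2.13–2.14, §5.14.
* [BorelJacquet1979] A. Borel, H. Jacquet, *Automorphic forms and automorphic representations*, PSPM 33.1 (1979), §4.2, §4.6.
* [BorelWallach2000] A. Borel, N. Wallach, *Continuous cohomology, discrete subgroups, and representations of reductive groups*,
  2nd ed. (2000), VII 2.10.
-/

set_option autoImplicit false

-- the mandated namespace has the single-problem summit's repeated segment (`HodgeConjecture.HodgeConjecture`)
set_option linter.dupNamespace false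

noncomputable section

namespace Summit.HodgeConjecture.HodgeConjecture.Cruxes.H413.F0P2dStubSCotFormL2Data

open MeasureTheory NumberField MulAction Filter Topology
open scoped Matrix ComplexOrder ENNReal NNReal
open Literature.NumberTheory.Automorphic Literature.NumberTheory.Automorphic.UnitaryGroup
open Literature.NumberTheory.Automorphic.UnitaryGroup.CotangentForms
open Literature.AlgebraicGeometry.ShimuraVarieties Literature.AlgebraicGeometry.ShimuraVarieties.BallForms
open Literature.Geometry.ComplexHyperbolic.BallModel (U21 x₀)
open Summit.HodgeConjecture.HodgeConjecture.Cruxes.H413.SpectrumJunction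
open Summit.HodgeConjecture.HodgeConjecture.Cruxes.H413.F0P2aL2bHolLieSpanPackage
open Summit.HodgeConjecture.HodgeConjecture.Cruxes.H413.F0P2aArchOrthPrelim
open Summit.HodgeConjecture.HodgeConjecture.Cruxes.H413.F0P2dStubSOrbitMap

/-! ## §1 `L²` dictionary: right invariances and the `K_∞`-type relation -/

section L2Dictionary

variable {K : Type} [Field K] [NumberField K] {𝒢 : AdelicGroupData.{0} K} {μ : Measure 𝒢.automorphicQuotient}


/-- **Pointwise right invariance ⇒ `L²` invariance**: if `Φ(x a) = Φ(x)` for all `x` then `R(a)[Φ] = [Φ]`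
(dictionary `R(a)[Φ] = [Φ(· a)]`, ★ `SpectrumJunction.toLp_toQuotFun_mul_right`). [cite: BorelJacquet1979, §4.2 and §4.6] -/
theorem rightRegular_toLp_toQuotFun_eq_self [SMulInvariantMeasure 𝒢.Adelic 𝒢.automorphicQuotient μ]
    {Φ : 𝒢.Adelic → ℂ} (hΦ : ∀ γ ∈ 𝒢.quotientSubgroup, ∀ g, Φ (γ * g) = Φ g)
    (hmem : MemLp (toQuotFun 𝒢 Φ) 2 μ) {a : 𝒢.Adelic} (h : ∀ x, Φ (x * a) = Φ x) :
    𝒢.rightRegular μ a (hmem.toLp (toQuotFun 𝒢 Φ)) = hmem.toLp (toQuotFun 𝒢 Φ) := by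
  have e : (fun x => Φ (x * a)) = Φ := funext h
  have hmem' : MemLp (toQuotFun 𝒢 fun x => Φ (x * a)) 2 μ := by rw [e]; exact hmem
  rw [← toLp_toQuotFun_mul_right hΦ a hmem hmem']
  exact MemLp.toLp_congr hmem' hmem (Filter.EventuallyEq.of_eq (by rw [e]))

/-- **Pointwise type relation ⇒ `L²` type relation**: if `Φ(x a)_j = Σ_i c_i Φ(x)_i` for all `x` then
`R(a)[Φ·j] = Σ_i c_i • [Φ·i]` (★ `SpectrumJunction.toLp_toQuotFun_mul_right`, ★ `F0P2dStubT.toQuotFun_sum_two_ae_eq`).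
[cite: BorelJacquet1979, §4.2 and §4.6] -/
theorem rightRegular_toLp_toQuotFun_eq_sum_two [SMulInvariantMeasure 𝒢.Adelic 𝒢.automorphicQuotient μ]
    {Φ : 𝒢.Adelic → (Fin 2 → ℂ)} (hΦ : ∀ γ ∈ 𝒢.quotientSubgroup, ∀ g, Φ (γ * g) = Φ g)
    (hmem : ∀ i : Fin 2, MemLp (toQuotFun 𝒢 fun x => Φ x i) 2 μ) {a : 𝒢.Adelic} (c : Fin 2 → ℂ) (j : Fin 2)
    (h : ∀ x, Φ (x * a) j = ∑ i : Fin 2, c i * Φ x i) :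
    𝒢.rightRegular μ a ((hmem j).toLp (toQuotFun 𝒢 fun x => Φ x j)) =
      ∑ i : Fin 2, c i • (hmem i).toLp (toQuotFun 𝒢 fun x => Φ x i) := by
  have hleftj : ∀ γ ∈ 𝒢.quotientSubgroup, ∀ g, (fun x => Φ x j) (γ * g) = (fun x => Φ x j) g :=
    fun γ hγ g => by simp only [hΦ γ hγ g]
  have e2 : (toQuotFun 𝒢 fun x => (fun x => Φ x j) (x * a)) = toQuotFun 𝒢 fun x => ∑ i : Fin 2, c i * Φ x i := by
    funext y; simp only [toQuotFun, h]
  have hmem' : MemLp (toQuotFun 𝒢 fun x => (fun x => Φ x j) (x * a)) 2 μ := by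
    have e : (toQuotFun 𝒢 fun x => (fun x => Φ x j) (x * a)) =
        fun y => c 0 * toQuotFun 𝒢 (fun x => Φ x 0) y + c 1 * toQuotFun 𝒢 (fun x => Φ x 1) y := by
      funext y; simp only [toQuotFun, h, Fin.sum_univ_two]
    rw [e]
    exact ((hmem 0).const_mul (c 0)).add ((hmem 1).const_mul (c 1))
  rw [← toLp_toQuotFun_mul_right hleftj a (hmem j) hmem']
  apply Lp.ext
  have h2 := F0P2dStubT.toQuotFun_sum_two_ae_eq (fun i => fun x => Φ x i)
    (fun i => (hmem i).toLp (toQuotFun 𝒢 fun x => Φ x i)) (fun i => (hmem i).coeFn_toLp.symm) c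
  refine hmem'.coeFn_toLp.trans ?_
  rw [e2]
  exact h2

end L2Dictionary

/-! ## §2 The CM frame: assembly of STUB (S) -/

section CM

/-- **STUB (S) `stub_S_cotFormL2Data` of `Lines/F0_P2SpectralProjectionD.lean` — the body of `StubSCotFormL2Data` binder for
binder** (`G3` unfolded; `IsRegularKernel A` as its four fields `cont`, `supp`, `diff`, `contDeriv` — the last two are not
needed; `IsReproducedAlong` unfolded; conclusion = the six fields `repro`, `kc`, `kf`, `ktype`, `diffOrbit`, `weakHol` of
`IsL2CotPair` with `kernelOp`, `orbitP`, `IsWeaklyHol` unfolded).  For the CM frame (`L` CM, `[L⁺:ℚ] ≥ 2`, `H` of signature `(2,1)` at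
`ι` with frame `T` and positive definite at the other places — so the automorphic quotient is compact — `μ` automorphic), a
continuous compactly supported kernel `A` reproducing along `cmArchSection`, and `Φ ∈ holCotForms` with square-integrable
coordinates, the pair `u_j := [Φ·j]` carries the `L²`-level cotangent data. [cite: Borel1997, §2.13 and §5.14]
[cite: BorelJacquet1979, §4.2 and §4.6] [cite: BorelWallach2000, VII 2.10] -/
theorem stubSCotFormL2Data_holds :
    ∀ (L : Type) [Field L] [NumberField L] [IsCMField L] (ι : L →+* ℂ) (H : Matrix (Fin 3) (Fin 3) L) (T : GL (Fin 3) ℂ)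
    (hT : (T : Matrix (Fin 3) (Fin 3) ℂ)ᴴ * H.map ι * (T : Matrix (Fin 3) (Fin 3) ℂ) = Literature.Geometry.ComplexHyperbolic.BallModel.J),
    (∀ τ' : L →+* ℂ, InfinitePlace.mk τ' ≠ InfinitePlace.mk ι → (H.map τ').PosDef) →
    2 ≤ Module.finrank ℚ ↥(maximalRealSubfield L) →
    ∀ (μ : Measure (adelicGroupData (↥(maximalRealSubfield L)) L (IsCMField.complexConj L) 3 H).automorphicQuotient)
      [(adelicGroupData (↥(maximalRealSubfield L)) L (IsCMField.complexConj L) 3 H).IsAutomorphicMeasure μ]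
      (ν : Measure U21) [ν.IsHaarMeasure] (A : U21 → Matrix (Fin 2) (Fin 2) ℂ),
      -- `IsRegularKernel A`, field by field
      Continuous A → HasCompactSupport A →
      (∀ (j i : Fin 2) (u' : U21), ContDiff ℝ 1 fun b : Fin 2 → ℂ => A (BallForms.expP b * u') j i) →
      (∀ j i : Fin 2,
        Continuous fun p : (Fin 2 → ℂ) × U21 => fderiv ℝ (fun b : Fin 2 → ℂ => A (BallForms.expP b * p.2) j i) p.1) →
      -- `IsReproducedAlong (cmArchSection L ι H T hT) ν A`
      (∀ Φ : (adelicGroupData (↥(maximalRealSubfield L)) L (IsCMField.complexConj L) 3 H).Adelic → (Fin 2 → ℂ),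
        (∀ (k : stabilizer (↥U21) x₀) (g : (adelicGroupData (↥(maximalRealSubfield L)) L (IsCMField.complexConj L) 3 H).Adelic),
            Φ (g * cmArchSection L ι H T hT k) = BallForms.isPullbackCocycle_cotangentCocycle.weightOf x₀ k⁻¹ (Φ g)) →
        IsHolGerm (cmArchSection L ι H T hT) Φ →
          ∀ y : (adelicGroupData (↥(maximalRealSubfield L)) L (IsCMField.complexConj L) 3 H).Adelic,
            ∫ u, A u *ᵥ Φ (y * cmArchSection L ι H T hT u) ∂ν = Φ y) →
    ∀ (Φ : (adelicGroupData (↥(maximalRealSubfield L)) L (IsCMField.complexConj L) 3 H).Adelic → (Fin 2 → ℂ)),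
      Φ ∈ holCotForms (↥(maximalRealSubfield L)) L (IsCMField.complexConj L) 3 H (cmArchSection L ι H T hT)
          (cmCompactFactor L ι H T hT) →
    ∀ hΦ : ∀ j : Fin 2, MemLp (toQuotFun (adelicGroupData (↥(maximalRealSubfield L)) L (IsCMField.complexConj L) 3 H)
        fun g => Φ g j) 2 μ,
      -- `IsL2CotPair L ι H T hT μ ν A (fun j => MemLp.toLp (toQuotFun (G3 L H) fun g => Φ g j) (hΦ j))`, field by field
      (∀ j, (∑ i : Fin 2, ∫ u, A u j i •
          (adelicGroupData (↥(maximalRealSubfield L)) L (IsCMField.complexConj L) 3 H).rightRegular μ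
            (cmArchSection L ι H T hT u)
            (MemLp.toLp (toQuotFun (adelicGroupData (↥(maximalRealSubfield L)) L (IsCMField.complexConj L) 3 H)
              fun g => Φ g i) (hΦ i)) ∂ν) =
        MemLp.toLp (toQuotFun (adelicGroupData (↥(maximalRealSubfield L)) L (IsCMField.complexConj L) 3 H)
          fun g => Φ g j) (hΦ j)) ∧
      (∀ k ∈ cmCompactFactor L ι H T hT, ∀ j,
        (adelicGroupData (↥(maximalRealSubfield L)) L (IsCMField.complexConj L) 3 H).rightRegular μ k
            (MemLp.toLp (toQuotFun (adelicGroupData (↥(maximalRealSubfield L)) L (IsCMField.complexConj L) 3 H)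
              fun g => Φ g j) (hΦ j)) =
          MemLp.toLp (toQuotFun (adelicGroupData (↥(maximalRealSubfield L)) L (IsCMField.complexConj L) 3 H)
            fun g => Φ g j) (hΦ j)) ∧
      (∃ Kf : Subgroup (finAdelic (↥(maximalRealSubfield L)) L (IsCMField.complexConj L) 3 H),
        IsOpen (Kf : Set (finAdelic (↥(maximalRealSubfield L)) L (IsCMField.complexConj L) 3 H)) ∧
          ∀ k ∈ Kf, ∀ j,
            (adelicGroupData (↥(maximalRealSubfield L)) L (IsCMField.complexConj L) 3 H).rightRegular μ
                (finAdelicToAdelic (↥(maximalRealSubfield L)) L (IsCMField.complexConj L) 3 H k)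
                (MemLp.toLp (toQuotFun (adelicGroupData (↥(maximalRealSubfield L)) L (IsCMField.complexConj L) 3 H)
                  fun g => Φ g j) (hΦ j)) =
              MemLp.toLp (toQuotFun (adelicGroupData (↥(maximalRealSubfield L)) L (IsCMField.complexConj L) 3 H)
                fun g => Φ g j) (hΦ j)) ∧
      (∀ (k : stabilizer (↥U21) x₀) (j : Fin 2),
        (adelicGroupData (↥(maximalRealSubfield L)) L (IsCMField.complexConj L) 3 H).rightRegular μ
            (cmArchSection L ι H T hT k)
            (MemLp.toLp (toQuotFun (adelicGroupData (↥(maximalRealSubfield L)) L (IsCMField.complexConj L) 3 H)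
              fun g => Φ g j) (hΦ j)) =
          ∑ i : Fin 2, (BallForms.isPullbackCocycle_cotangentCocycle.weightOf x₀ k⁻¹ (Pi.single i 1)) j •
            MemLp.toLp (toQuotFun (adelicGroupData (↥(maximalRealSubfield L)) L (IsCMField.complexConj L) 3 H)
              fun g => Φ g i) (hΦ i)) ∧
      (∀ j, DifferentiableAt ℝ
        (fun b : Fin 2 → ℂ => (adelicGroupData (↥(maximalRealSubfield L)) L (IsCMField.complexConj L) 3 H).rightRegular μ
          (cmArchSection L ι H T hT (BallForms.expP b))
          (MemLp.toLp (toQuotFun (adelicGroupData (↥(maximalRealSubfield L)) L (IsCMField.complexConj L) 3 H)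
            fun g => Φ g j) (hΦ j))) 0) ∧
      (∀ j, ∀ b : Fin 2 → ℂ,
        fderiv ℝ (fun b : Fin 2 → ℂ =>
            (adelicGroupData (↥(maximalRealSubfield L)) L (IsCMField.complexConj L) 3 H).rightRegular μ
              (cmArchSection L ι H T hT (BallForms.expP b))
              (MemLp.toLp (toQuotFun (adelicGroupData (↥(maximalRealSubfield L)) L (IsCMField.complexConj L) 3 H)
                fun g => Φ g j) (hΦ j))) 0 (Complex.I • b) =
          Complex.I • fderiv ℝ (fun b : Fin 2 → ℂ =>
            (adelicGroupData (↥(maximalRealSubfield L)) L (IsCMField.complexConj L) 3 H).rightRegular μ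
              (cmArchSection L ι H T hT (BallForms.expP b))
              (MemLp.toLp (toQuotFun (adelicGroupData (↥(maximalRealSubfield L)) L (IsCMField.complexConj L) 3 H)
                fun g => Φ g j) (hΦ j))) 0 b) := by
  intro L _ _ _ ι H T hT hdef h2 μ _ ν _ A hAc hAs _ _ hrep Φ hΦ hΦ2
  -- the archimedean section, the compact quotient, the regularity package of `Φ`
  have hιc : Continuous (cmArchSection L ι H T hT) := continuous_archSectionU21CM L ι H T hT
  have h4 : 4 ≤ Module.finrank ℚ L := by
    have h := Module.finrank_mul_finrank ℚ ↥(maximalRealSubfield L) L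
    rw [Algebra.IsQuadraticExtension.finrank_eq_two ↥(maximalRealSubfield L) L] at h
    omega
  obtain ⟨τ, hτ⟩ := exists_infinitePlace_ne L h4 ι
  haveI : CompactSpace (adelicGroupData (↥(maximalRealSubfield L)) L (IsCMField.complexConj L) 3 H).automorphicQuotient :=
    compactSpace_cmDatum_automorphicQuotient_of_posDef L 3 H τ (hdef τ hτ)
  have hleft : ∀ γ ∈ (adelicGroupData (↥(maximalRealSubfield L)) L (IsCMField.complexConj L) 3 H).quotientSubgroup, ∀ g,
      Φ (γ * g) = Φ g := SpectrumJunction.leftInvariant_of_mem_holCotForms hΦ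
  have hleftj : ∀ j : Fin 2, ∀ γ ∈ (adelicGroupData (↥(maximalRealSubfield L)) L (IsCMField.complexConj L) 3 H).quotientSubgroup,
      ∀ g, (fun x => Φ x j) (γ * g) = (fun x => Φ x j) g := fun j γ hγ g => by simp only [hleft γ hγ g]
  obtain ⟨hW, hKc, -, hH⟩ := mem_holCotForms_iff.1 hΦ
  obtain ⟨Kf, hKo, hreg⟩ := span_iterLieDeriv_hol_regular hΦ
  have hgen : ∀ (w : List u21Group.lie) (j : Fin 2),
      iterLieDeriv (H := u21Group) (cmArchSection L ι H T hT) w (fun x => Φ x j) ∈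
        Submodule.span ℂ (Set.range fun p : List u21Group.lie × Fin 2 =>
          iterLieDeriv (H := u21Group) (cmArchSection L ι H T hT) p.1 fun x => Φ x p.2) :=
    fun w j => Submodule.subset_span ⟨(w, j), rfl⟩
  have hcontj : ∀ j : Fin 2, Continuous fun x => Φ x j := fun j => (hreg _ (hgen [] j)).1
  have hcont : Continuous Φ := continuous_pi hcontj
  -- the pointwise reproduction of `Φ`
  have hrepΦ := hrep Φ (fun k g => WeightForms.right_equiv hW k g) hH
  refine ⟨fun j => sum_integral_smul_rightRegular_toLp_eq_self ν hιc hAc hAs hleft hcont hΦ2 hrepΦ j,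
    fun k hk j => rightRegular_toLp_toQuotFun_eq_self (hleftj j) (hΦ2 j) fun x => by simp only [hKc k hk x],
    ⟨Kf, hKo, fun k hk j => rightRegular_toLp_toQuotFun_eq_self (hleftj j) (hΦ2 j) fun x =>
      (hreg _ (hgen [] j)).2.2.2 k hk x⟩,
    fun k j => rightRegular_toLp_toQuotFun_eq_sum_two hleft hΦ2 _ j fun x => ?_, ?_⟩
  · -- the cotangent `K_∞`-type identity, coordinate `j`
    have h := WeightForms.right_equiv hW k x
    refine (congrFun h j).trans ?_
    have e : (BallForms.isPullbackCocycle_cotangentCocycle.weightOf x₀ k⁻¹) (Φ x) =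
        ∑ i : Fin 2, Φ x i • (BallForms.isPullbackCocycle_cotangentCocycle.weightOf x₀ k⁻¹) (Pi.single i 1) := by
      conv_lhs => rw [pi_eq_sum_univ' (Φ x)]
      rw [map_sum]
      simp only [map_smul]
    rw [e, Finset.sum_apply]
    simp only [Pi.smul_apply, smul_eq_mul]
    exact Finset.sum_congr rfl fun i _ => mul_comm _ _
  -- `diffOrbit` and `weakHol`, coordinate by coordinate (★ `F0P2dStubSOrbitMap`)
  have hmain : ∀ j : Fin 2,
      DifferentiableAt ℝ (fun b : Fin 2 → ℂ =>
        (adelicGroupData (↥(maximalRealSubfield L)) L (IsCMField.complexConj L) 3 H).rightRegular μ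
          (cmArchSection L ι H T hT (BallForms.expP b))
          (MemLp.toLp (toQuotFun (adelicGroupData (↥(maximalRealSubfield L)) L (IsCMField.complexConj L) 3 H)
            fun g => Φ g j) (hΦ2 j))) 0 ∧
      ∀ b : Fin 2 → ℂ,
        fderiv ℝ (fun b : Fin 2 → ℂ =>
            (adelicGroupData (↥(maximalRealSubfield L)) L (IsCMField.complexConj L) 3 H).rightRegular μ
              (cmArchSection L ι H T hT (BallForms.expP b))
              (MemLp.toLp (toQuotFun (adelicGroupData (↥(maximalRealSubfield L)) L (IsCMField.complexConj L) 3 H)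
                fun g => Φ g j) (hΦ2 j))) 0 (Complex.I • b) =
          Complex.I • fderiv ℝ (fun b : Fin 2 → ℂ =>
            (adelicGroupData (↥(maximalRealSubfield L)) L (IsCMField.complexConj L) 3 H).rightRegular μ
              (cmArchSection L ι H T hT (BallForms.expP b))
              (MemLp.toLp (toQuotFun (adelicGroupData (↥(maximalRealSubfield L)) L (IsCMField.complexConj L) 3 H)
                fun g => Φ g j) (hΦ2 j))) 0 b := by
    intro j
    -- bounds for the sixteen second Lie derivatives on the compact quotient
    have hb : ∀ p : (Fin 2 × Fin 2) × (Fin 2 × Fin 2), ∃ C : ℝ, ∀ g,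
        ‖lieDeriv (H := u21Group) (cmArchSection L ι H T hT)
            (liePMat (Pi.single p.1.1 (if p.1.2 = 0 then (1 : ℂ) else Complex.I)))
          (lieDeriv (H := u21Group) (cmArchSection L ι H T hT)
            (liePMat (Pi.single p.2.1 (if p.2.2 = 0 then (1 : ℂ) else Complex.I))) fun x => Φ x j) g‖ ≤ C :=
      fun p => span_iterLieDeriv_hol_bounded hΦ (hgen [liePMat (Pi.single p.1.1 (if p.1.2 = 0 then (1 : ℂ) else Complex.I)),
        liePMat (Pi.single p.2.1 (if p.2.2 = 0 then (1 : ℂ) else Complex.I))] j)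
    choose C hC using hb
    have hM : ∀ (q q' : Fin 2 × Fin 2) (g : (adelicGroupData (↥(maximalRealSubfield L)) L (IsCMField.complexConj L) 3 H).Adelic),
        ‖lieDeriv (H := u21Group) (cmArchSection L ι H T hT)
            (liePMat (Pi.single q.1 (if q.2 = 0 then (1 : ℂ) else Complex.I)))
          (lieDeriv (H := u21Group) (cmArchSection L ι H T hT)
            (liePMat (Pi.single q'.1 (if q'.2 = 0 then (1 : ℂ) else Complex.I))) fun x => Φ x j) g‖ ≤
          ∑ p : (Fin 2 × Fin 2) × (Fin 2 × Fin 2), |C p| := fun q q' g =>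
      ((hC (q, q') g).trans (le_abs_self _)).trans
        (Finset.single_le_sum (f := fun p => |C p|) (fun p _ => abs_nonneg _) (Finset.mem_univ (q, q')))
    have hCR : ∀ i : Fin 2, lieDeriv (H := u21Group) (cmArchSection L ι H T hT) (liePMat (Pi.single i Complex.I)) (fun x => Φ x j) =
        Complex.I • lieDeriv (H := u21Group) (cmArchSection L ι H T hT) (liePMat (Pi.single i 1)) fun x => Φ x j := by
      intro i
      have e : (Pi.single i Complex.I : Fin 2 → ℂ) = Complex.I • (Pi.single i (1 : ℂ) : Fin 2 → ℂ) := by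
        funext j'
        by_cases hj : j' = i
        · subst hj; simp
        · simp [hj]
      rw [e]
      exact lieDeriv_liePMat_I_smul_of_isHolGerm hH (Pi.single i 1) j
    exact differentiableAt_rightRegular_expP_toLp (hleftj j) (hcontj j)
      (F0P2aL2bHolArchSmooth.isArchSmooth_apply_of_mem_holCotForms_cm L ι H T hT hΦ j)
      (fun i => ⟨(hreg _ (hgen [liePMat (Pi.single i 1)] j)).1, (hreg _ (hgen [liePMat (Pi.single i 1)] j)).2.1⟩)
      hCR hM (hΦ2 j)
  exact ⟨fun j => (hmain j).1, fun j b => (hmain j).2 b⟩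

end CM

end Summit.HodgeConjecture.HodgeConjecture.Cruxes.H413.F0P2dStubSCotFormL2Data

end
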